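import Literature.NumberTheory.LFunctions.SaiasWeingartnerSteering
import Literature.NumberTheory.LFunctions.SaiasWeingartnerBudget
import Literature.NumberTheory.LFunctions.SaiasWeingartnerTwist
import HarnessLib

/-!
# Prescribing the tails of Euler products of several Dirichlet `L`-series by prime phases

Topic `Literature/NumberTheory/LFunctions` (namespace `Literature.NumberTheory.LFunctions`).
Everything in this file is PROVED; there are no definitions and no named facts.

This is Lemma 2 of Saias–Weingartner (*Zeros of Dirichlet series with periodic coefficients*,
Acta Arith. 140 (2009), §3) in the form needed for their Theorem 2: for pairwise distinct
Dirichlet characters `ψ_j` modulo `Q`, a cut-off `y ≥ Q` and a bound `W`, there is `η > 0`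
such that for every `1 < σ ≤ 1 + η` and all targets `z_j` with `|z_j| ≤ W` one can choose real
phases `θ_p` (`p > y` prime) with
`∑_{p > y} -log (1 - ψ_j(p) e^{iθ_p} p^{-σ}) = z_j` for every `j` simultaneously
(`SWPhases.exists_phases`; exponentiating gives `∏_{p>y} (1 - ψ_j(p) e^{iθ_p} p^{-σ})⁻¹ = e^{z_j}`,
the printed "`= z_j`, `1/R ≤ |z_j| ≤ R`"). The paper proves this with the Brouwer fixed point
theorem (its Lemma 1 solves the linearised system continuously); here it follows from the greedy
steering lemma `SWSteering.exists_phases_hasSum` with classes the reduced residues mod `Q`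
(coordinates `w_a = φ(Q)⁻¹ ∑_j ψ_j(a)⁻¹ z_j`, row orthogonality `SWTwist.sum_units_mul_inv`),
radii `p^{-σ}`, drifts the second-order terms `-log(1 - x) - x`, and the budgets of
`SWBudget.exists_eta_budget` (prime number theorem for arithmetic progressions).

## References

* [SaiasWeingartner2009] E. Saias, A. Weingartner, Acta Arith. 140 (2009), 335–344, §3,
  Lemmas 1–2.
-/

noncomputable section

open Complex Filter Finset
open scoped Topology

namespace Literature.NumberTheory.LFunctions

namespace SWPhases

/-- Norm of the local parameter `ψ(k) e^{iθ} k^{-σ}`: at most `k^{-1} ≤ 1/2` for `k ≥ 2`,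
`σ ≥ 1`. [folklore] -/
theorem norm_local_le {Q : ℕ} (ψ : DirichletCharacter ℂ Q) {σ : ℝ} (hσ : 1 ≤ σ) (θ : ℝ) {k : ℕ}
    (hk : 2 ≤ k) : ‖ψ k * cexp (θ * I) * (k : ℂ) ^ (-(σ : ℂ))‖ ≤ (k : ℝ)⁻¹ := by
  have hk0 : 0 < k := by omega
  rw [norm_mul, norm_mul, norm_exp_ofReal_mul_I, mul_one, show (-(σ : ℂ)) = ((-σ : ℝ) : ℂ) by
    push_cast; ring, ← ofReal_natCast, ← ofReal_cpow (Nat.cast_nonneg k), norm_real,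
    Real.norm_of_nonneg (Real.rpow_nonneg (Nat.cast_nonneg k) _)]
  have h1 : (k : ℝ) ^ (-σ) ≤ (k : ℝ) ^ (-(1 : ℝ)) :=
    Real.rpow_le_rpow_of_exponent_le (by exact_mod_cast hk0) (by linarith)
  rw [Real.rpow_neg_one] at h1
  calc ‖ψ k‖ * (k : ℝ) ^ (-σ) ≤ 1 * (k : ℝ)⁻¹ := by
        gcongr
        · exact ψ.norm_le_one _
    _ = (k : ℝ)⁻¹ := one_mul _

/-- **Prescribing the Euler tails by prime phases** ([SaiasWeingartner2009], Lemma 2, in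
logarithmic form and for the characters restricted to the primes `p > y`). Let `ψ_j`
(`j ∈ ι`) be pairwise distinct Dirichlet characters mod `Q`, `y ≥ Q`, `W ≥ 0`. There is
`η ∈ (0, 1/2]` such that for all `1 < σ ≤ 1 + η` and all targets `z` with `‖z j‖ ≤ W` there are
real phases `θ` with `∑_{p > y prime} -log (1 - ψ_j(p) e^{iθ_p} p^{-σ}) = z_j` for every `j`
(as a `HasSum` over `ℕ` of the sequence vanishing off the primes `> y`).
[cite: SaiasWeingartner2009, Lemma 2] -/
theorem exists_phases {ι : Type*} [Fintype ι] {Q : ℕ} [NeZero Q]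
    (ψ : ι → DirichletCharacter ℂ Q) (hψ : Function.Injective ψ) {y : ℕ} (hQy : Q ≤ y) {W : ℝ}
    (hW : 0 ≤ W) :
    ∃ η : ℝ, 0 < η ∧ η ≤ 1 / 2 ∧ ∀ σ : ℝ, 1 < σ → σ ≤ 1 + η →
      ∀ z : ι → ℂ, (∀ i, ‖z i‖ ≤ W) →
        ∃ θ : ℕ → ℝ, ∀ i, HasSum (fun k : ℕ ↦ if k.Prime ∧ y < k then
            -log (1 - ψ i k * cexp (θ k * I) * (k : ℂ) ^ (-(σ : ℂ))) else 0) (z i) := by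
  classical
  -- classes: reduced residues mod `Q`
  set u : ℕ → (ZMod Q)ˣ := fun k ↦ if h : IsUnit (k : ZMod Q) then h.unit else 1 with hudef
  have hu : ∀ k, k.Prime → y < k → ((u k : ZMod Q) = (k : ZMod Q)) := by
    intro k hk hyk
    have hcop : k.Coprime Q := (Nat.Prime.coprime_iff_not_dvd hk).2
      fun h ↦ absurd (Nat.le_of_dvd (NeZero.pos Q) h) (by omega)
    have hunit : IsUnit (k : ZMod Q) := (ZMod.isUnit_iff_coprime k Q).2 hcop
    show ((if h : IsUnit (k : ZMod Q) then h.unit else 1 : (ZMod Q)ˣ) : ZMod Q) = k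
    rw [dif_pos hunit]
    exact hunit.unit_spec
  set n : ℝ := (Fintype.card ι : ℝ) with hndef
  have hn0 : 0 ≤ n := Nat.cast_nonneg _
  obtain ⟨η, hη, hη2, hbudget⟩ :=
    SWBudget.exists_eta_budget (q := Q) (y := y) u hu (W := n * W) (C := n) (by positivity) hn0
  refine ⟨η, hη, hη2, fun σ hσ1 hσ z hz ↦ ?_⟩
  obtain ⟨hbw, hbstep⟩ := hbudget σ hσ1 hσ
  have hφ0 : (0 : ℝ) < Q.totient := by exact_mod_cast Nat.totient_pos.2 (NeZero.pos Q)
  have hφ1 : (1 : ℝ) ≤ Q.totient := by exact_mod_cast Nat.totient_pos.2 (NeZero.pos Q)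
  have hφinv : ‖((Q.totient : ℂ))⁻¹‖ ≤ 1 := by
    rw [norm_inv, norm_natCast]
    exact inv_le_one_of_one_le₀ hφ1
  -- the data of the steering lemma
  set r : ℕ → ℝ := fun k ↦ if k.Prime ∧ y < k then (k : ℝ) ^ (-σ) else 0 with hrdef
  set ρ : ι → ℕ → ℝ → ℂ := fun i k θ ↦
    -log (1 - ψ i k * cexp (θ * I) * (k : ℂ) ^ (-(σ : ℂ))) -
      ψ i k * cexp (θ * I) * (k : ℂ) ^ (-(σ : ℂ)) with hρdef
  set D : ℕ → ℝ → (ZMod Q)ˣ → ℂ := fun k θ a ↦ if k.Prime ∧ y < k then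
    ((Q.totient : ℂ))⁻¹ * ∑ i, (ψ i a)⁻¹ * ρ i k θ else 0 with hDdef
  set δ : ℕ → ℝ := fun k ↦ n / (k : ℝ) ^ 2 with hδdef
  set w : (ZMod Q)ˣ → ℂ := fun a ↦ ((Q.totient : ℂ))⁻¹ * ∑ i, (ψ i a)⁻¹ * z i with hwdef
  -- hypotheses of the steering lemma
  have hr : ∀ k, 0 ≤ r k := fun k ↦ by
    simp only [hrdef]; split_ifs
    · exact Real.rpow_nonneg (Nat.cast_nonneg _) _
    · exact le_rfl
  have hrs : Summable r := SWBudget.summable_indicator_rpow hσ1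
  have hδs : Summable δ :=
    ((Real.summable_one_div_nat_pow.mpr one_lt_two).mul_left n).congr fun k ↦ mul_one_div n _
  have hinvψ : ∀ (i : ι) (a : (ZMod Q)ˣ), ‖(ψ i a)⁻¹‖ = 1 := fun i a ↦ by
    rw [norm_inv, (ψ i).unit_norm_eq_one a, inv_one]
  -- the second-order term of the logarithm (cf. `norm_neg_log_one_sub_sub_le` in
  -- `PretentiousZeta.lean`): `‖-log(1 - x) - x‖ ≤ ‖x‖²` for `‖x‖ ≤ 1/2`
  have hlog2 : ∀ x : ℂ, ‖x‖ ≤ 1 / 2 → ‖-log (1 - x) - x‖ ≤ ‖x‖ ^ 2 := by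
    intro x hx
    have hx1 : ‖x‖ < 1 := by linarith
    have h := norm_log_one_sub_inv_sub_self_le hx1
    rw [Complex.log_inv _ (Complex.slitPlane_arg_ne_pi ?_)] at h
    · refine h.trans ?_
      have h2 : (1 - ‖x‖)⁻¹ ≤ 2 := by
        rw [inv_le_comm₀ (by linarith) two_pos]; linarith
      have h3 : 0 ≤ ‖x‖ ^ 2 := sq_nonneg _
      calc ‖x‖ ^ 2 * (1 - ‖x‖)⁻¹ / 2 ≤ ‖x‖ ^ 2 * 2 / 2 := by gcongr
        _ = ‖x‖ ^ 2 := by ring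
    · rw [sub_eq_add_neg]
      exact mem_slitPlane_of_norm_lt_one (by rwa [norm_neg])
  have hρ : ∀ i k θ, k.Prime → ‖ρ i k θ‖ ≤ 1 / (k : ℝ) ^ 2 := by
    intro i k θ hk
    have hk2 := hk.two_le
    have hloc := norm_local_le (ψ i) hσ1.le θ hk2
    have hk0 : (0 : ℝ) < k := by exact_mod_cast hk.pos
    have hhalf : ‖ψ i k * cexp (θ * I) * (k : ℂ) ^ (-(σ : ℂ))‖ ≤ 1 / 2 := by
      refine hloc.trans ?_
      rw [show (1 : ℝ) / 2 = (2 : ℝ)⁻¹ by norm_num]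
      exact inv_anti₀ two_pos (by exact_mod_cast hk2)
    refine (hlog2 _ hhalf).trans ?_
    rw [one_div, ← inv_pow]
    exact pow_le_pow_left₀ (norm_nonneg _) hloc 2
  have hD : ∀ k θ a, ‖D k θ a‖ ≤ δ k := by
    intro k θ a
    simp only [hDdef, hδdef]
    split_ifs with hk
    · rw [norm_mul]
      refine (mul_le_of_le_one_left (norm_nonneg _) hφinv).trans ?_
      refine (norm_sum_le _ _).trans ?_
      have : ∀ i ∈ (univ : Finset ι), ‖(ψ i a)⁻¹ * ρ i k θ‖ ≤ 1 / (k : ℝ) ^ 2 := by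
        intro i _
        rw [norm_mul, hinvψ, one_mul]
        exact hρ i k θ hk.1
      refine (sum_le_sum this).trans ?_
      rw [sum_const, card_univ, nsmul_eq_mul, hndef]
      ring_nf
      exact le_rfl
    · rw [norm_zero]; positivity
  have hw : ∀ a, ‖w a‖ + ∑' k, δ k ≤ ∑' k, if u k = a then r k else 0 := by
    intro a
    refine le_trans (add_le_add ?_ le_rfl) (hbw a)
    simp only [hwdef]
    rw [norm_mul]
    refine (mul_le_of_le_one_left (norm_nonneg _) hφinv).trans ?_
    refine (norm_sum_le _ _).trans ?_
    have : ∀ i ∈ (univ : Finset ι), ‖(ψ i a)⁻¹ * z i‖ ≤ W := by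
      intro i _
      rw [norm_mul, hinvψ, one_mul]
      exact hz i
    refine (sum_le_sum this).trans ?_
    rw [sum_const, card_univ, nsmul_eq_mul, hndef]
  have hstep : ∀ k, 0 < r k →
      r k + ∑' m, δ (m + k) ≤ ∑' m, if u (m + (k + 1)) = u k then r (m + (k + 1)) else 0 :=
    fun k hk ↦ hbstep k hk
  obtain ⟨θ, hθ⟩ := SWSteering.exists_phases_hasSum hr hrs hδs hD hw hstep
  refine ⟨θ, fun i ↦ ?_⟩
  -- combine the coordinates with the weights `ψ i a`
  have hcomb := hasSum_sum fun (a : (ZMod Q)ˣ) (_ : a ∈ univ) ↦ (hθ a).mul_left (ψ i a)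
  -- the value
  have hφc : (Q.totient : ℂ) ≠ 0 := by exact_mod_cast hφ0.ne'
  -- row orthogonality, in the form used twice below
  have horth : ∀ f : ι → ℂ, ∑ a : (ZMod Q)ˣ, ψ i a * (((Q.totient : ℂ))⁻¹ * ∑ j, (ψ j a)⁻¹ * f j)
      = f i := by
    intro f
    simp_rw [Finset.mul_sum]
    rw [Finset.sum_comm]
    have : ∀ j, ∑ a : (ZMod Q)ˣ, ψ i a * (((Q.totient : ℂ))⁻¹ * ((ψ j a)⁻¹ * f j)) =
        ((Q.totient : ℂ))⁻¹ * f j * ∑ a : (ZMod Q)ˣ, ψ i a * (ψ j a)⁻¹ := by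
      intro j; rw [Finset.mul_sum]; exact sum_congr rfl fun a _ ↦ by ring
    simp_rw [this]
    rw [Finset.sum_eq_single i]
    · rw [SWTwist.sum_units_mul_inv, if_pos rfl]
      field_simp
    · intro j _ hji
      rw [SWTwist.sum_units_mul_inv, if_neg (fun h ↦ hji (hψ h).symm), mul_zero]
    · intro h; exact absurd (mem_univ i) h
  have hval : ∑ a : (ZMod Q)ˣ, ψ i a * w a = z i := horth z
  -- the terms
  have hterm : ∀ k, ∑ a : (ZMod Q)ˣ, ψ i a *
      ((if u k = a then (r k : ℂ) * cexp (θ k * I) else 0) + D k (θ k) a) =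
      (if k.Prime ∧ y < k then -log (1 - ψ i k * cexp (θ k * I) * (k : ℂ) ^ (-(σ : ℂ)))
        else 0) := by
    intro k
    by_cases hk : k.Prime ∧ y < k
    · rw [if_pos hk]
      simp only [hDdef, hrdef, if_pos hk, mul_add, sum_add_distrib]
      -- main term
      have hmain : ∑ a : (ZMod Q)ˣ, ψ i a * (if u k = a then (((k : ℝ) ^ (-σ) : ℝ) : ℂ) *
          cexp (θ k * I) else 0) = ψ i k * cexp (θ k * I) * (k : ℂ) ^ (-(σ : ℂ)) := by
        rw [Finset.sum_eq_single (u k)]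
        · rw [if_pos rfl, hu k hk.1 hk.2, show (-(σ : ℂ)) = ((-σ : ℝ) : ℂ) by push_cast; ring,
            ← ofReal_natCast, ← ofReal_cpow (Nat.cast_nonneg k)]
          ring
        · intro a _ ha
          rw [if_neg (Ne.symm ha), mul_zero]
        · intro h; exact absurd (mem_univ _) h
      -- drift term
      have hdrift : ∑ a : (ZMod Q)ˣ, ψ i a * (((Q.totient : ℂ))⁻¹ * ∑ j, (ψ j a)⁻¹ * ρ j k (θ k))
          = ρ i k (θ k) := horth fun j ↦ ρ j k (θ k)
      rw [hmain, hdrift]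
      simp only [hρdef]
      ring
    · rw [if_neg hk]
      simp only [hDdef, hrdef, if_neg hk]
      refine sum_eq_zero fun a _ ↦ ?_
      split_ifs <;> simp
  rw [hval] at hcomb
  simpa only [hterm] using hcomb

end SWPhases

end Literature.NumberTheory.LFunctions
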